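import Summits.ABC.ABC.Theorems.DefiniteXiXiStrongBoundDegreeCalibration
import Summits.ABC.ABC.Theorems.DefiniteXiXiStrongBoundPrimeCalibration
import HarnessLib

/-!
# Crux `XiStrongBound` (stmt-ABC-11337), route DefiniteXi — the degree calibration over ROUTE ITEMS:
# `XiStrongBound ⟺ FreyDegreeBound ⟺ prime rung` modulo Takahashi 2001 Thm. 2.3 and the r9 binders
# `IsogenyValuationTransport`, `MazurKenkuBound`, `FreyModularity`

The landed calibration files of this crux take two XL-apex Literature facts as hypotheses:
Pasten 2024 Lemma 6.8 (`h68 : PastenShimura2024_lemma_6_8`, in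
`DefiniteXiXiStrongBoundDegreeCalibration.lean`, p143906, and `…PrimeCalibration.lean`, p142547) and the
Mazur–Kenku degree transport (`h163 : PastenShimura2024_minimalDegree_le_163_mul`, in
`…PrimeCalibration.primeXiStrongBound_iff_freyDegreeBound_of_facts`).  Four route-choice units (d59cfa0c,
c66215d7, 5b441d71, 67b0e3d5; b81ca345 for the 163-transport) PROMOTED those facts to route cruxes of
rank 9 whose bodies repeat them verbatim: `IsogenyValuationTransport` (stmt-ABC-18928) and
`MazurKenkuBound` (stmt-ABC-15125).  This file restates the calibration over those ROUTE BINDERS, as the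
route-choice notes on stmt-ABC-11337 ask (the tree files being append-only, the rewiring is a new file,
not an in-place edit): after it, the certificate "the crux `XiStrongBound` is EXACTLY thesis-strength"
reads, hypothesis by hypothesis, as route items (`IsogenyValuationTransport`, `MazurKenkuBound`,
`FreyModularity`, all KNOWN in print) plus ONE printed theorem outside the ledger — Takahashi 2001
Thm. 2.3, in the tree's `D = 1` fact `takahashi2001_thm_2_3_of_coprime` and, for composite `N⁻`, in its
Shimura-curve forms `hTlev` / `hT2` (verbatim the section hypotheses of
`Literature/NumberTheory/Automorphic/ShimuraCurveRibetTakahashiBrandtCoordinatesProofs.lean` §III, there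
reduced further to the character-group dictionary, `…BrandtDictionaryProofs.lean`) — and Jacquet–Langlands
data (`nonempty_shimuraParametrizationData`, a named fact).

Contents: `isogenyValuationTransport_iff`, `mazurKenkuBound_iff` (the two promotions are definitional:
`Iff.rfl`); `definiteRTControlPrime_of_items` (r3 from Takahashi + the two r9 items);
`primeXiStrongBound_iff_freyDegreeBound_of_items` (prime rung ⟺ X); section `Takahashi` (hypotheses
`hTlev`, `hT2`, `hIVT`, `hJL`): `xiStrongBound_iff_freyDegreeBound_of_items'` and
`xiStrongBound_iff_primeXiStrongBound_of_items`; and the registered calibration sub-goal of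
stmt-ABC-11337, `xiStrongBound_iff_freyDegreeBound_of_items`, with every hypothesis explicit.  Not
restated here, because the landed declarations ALREADY accept the item in place of the fact (the gate's
dedup certifies the statements definitionally equal): `X ⟹ crux` at every rung is
`DefiniteXiXiStrongBoundDegreeCalibration.xiStrongBound_of_freyDegreeBound_of_facts hTlev hT2 hIVT hJL`, and
the pointwise comparison `ξ(N/Nm,Nm)·∏_{q∣Nm} v_q ≤ 163^{ω(Nm)} (∏_{q∣Nm} v_q)² deg D` is
`….brandtXi_mul_prod_le hTlev hT2 hIVT hJL …`, with `hIVT : IsogenyValuationTransport`.  No new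
mathematics: proof terms are those of p142547 / p143906 fed with the items.

## References

* [Takahashi2001] S. Takahashi, Degrees of parametrizations of elliptic curves by Shimura curves,
  J. Number Theory 90 (2001) 74–88: Thm. 2.3 (p. 79), p. 80, Thm. 3.2 (a) (p. 82), p. 84.
* [PastenShimura2024] H. Pasten, Shimura curves and the abc conjecture, J. Number Theory 254 (2024)
  = arXiv:1705.09251: §3 p. 13, Lemma 6.8 (p. 22), Prop. 6.13 (p. 23), §6.9 (p. 25).
* [Mazur1978] B. Mazur, Rational isogenies of prime degree, Invent. Math. 44 (1978), Thm. 1;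
  [Kenku1982] M. A. Kenku, J. London Math. Soc. (2) 23 (1981/82) — the bound `163`.
-/

-- `Summit.<Summit>.<Problem>`: for the single-conjunct summit `ABC` the duplicate `ABC.ABC` is mandated (D-0017).
set_option linter.dupNamespace false

noncomputable section
namespace Summit.ABC.ABC.Theorems.DefiniteXiXiStrongBoundItemsCalibration

open Summit.ABC.ABC.Theses.DefiniteXi
open Literature.NumberTheory.EllipticCurves Literature.NumberTheory.EllipticCurves.ModularForms
open Literature.NumberTheory.Automorphic
open Summit.ABC.ABC.Theorems.DefiniteXiXiStrongBoundDegreeCalibration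
open Summit.ABC.ABC.Theorems.DefiniteXiXiStrongBoundPrimeCalibration

/-! ## (0) The two route-choice promotions are definitional -/

/-- `IsogenyValuationTransport` (r9, stmt-ABC-18928) IS Pasten 2024 Lemma 6.8 as vendored in the tree
(`PastenShimura2024_lemma_6_8`): the route-choice promotion d59cfa0c repeated the body verbatim.
[cite: PastenShimura2024, Lemma 6.8 (p. 22)] -/
theorem isogenyValuationTransport_iff : IsogenyValuationTransport ↔ PastenShimura2024_lemma_6_8 :=
  Iff.rfl

/-- `MazurKenkuBound` (r9, stmt-ABC-15125) IS the Mazur–Kenku degree transport as vendored in the tree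
(`PastenShimura2024_minimalDegree_le_163_mul`): the route-choice promotion 1e5e4a86 repeated the body
verbatim. [cite: PastenShimura2024, §3 p. 13] [cite: Mazur1978, Thm. 1] -/
theorem mazurKenkuBound_iff : MazurKenkuBound ↔ PastenShimura2024_minimalDegree_le_163_mul :=
  Iff.rfl

/-! ## (1) The prime rung over items -/

/-- **r3 from items**: `DefiniteRTControlPrime` (stmt-ABC-11338) follows from Takahashi 2001 Thm. 2.3
at `q ∥ N` and the two r9 items `MazurKenkuBound`, `IsogenyValuationTransport` — the landed
`DefiniteRTControlPrime.definiteRTControlPrime_of_facts` fed with the items.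
[cite: Takahashi2001, Thm. 2.3 (p. 79), remark p. 80] [cite: PastenShimura2024, §3 p. 13 and Lemma 6.8 (p. 22)] -/
theorem definiteRTControlPrime_of_items (hT : takahashi2001_thm_2_3_of_coprime)
    (hMK : MazurKenkuBound) (hIVT : IsogenyValuationTransport) : DefiniteRTControlPrime :=
  DefiniteRTControlPrime.definiteRTControlPrime_of_facts hT hMK hIVT

/-- **Prime rung ⟺ X over items**: modulo Takahashi 2001 Thm. 2.3 at `q ∥ N` and the route items
`MazurKenkuBound`, `IsogenyValuationTransport`, `FreyModularity`, the prime rung of the crux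
(`ξ(N/q,q)·v_q(Δ_min) ≤ C_ε N^{2+ε}` for odd primes `q ∣ N`) is EQUIVALENT to `FreyDegreeBound` —
`…PrimeCalibration.primeXiStrongBound_iff_freyDegreeBound` with r3 discharged by
`definiteRTControlPrime_of_items`. [cite: Takahashi2001, Thm. 2.3 (p. 79)] [cite: PastenShimura2024, §3 p. 13 and Lemma 6.8 (p. 22)] -/
theorem primeXiStrongBound_iff_freyDegreeBound_of_items (hT : takahashi2001_thm_2_3_of_coprime)
    (hMK : MazurKenkuBound) (hIVT : IsogenyValuationTransport) (hMod : FreyModularity) :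
    (∀ ε : ℝ, 0 < ε → ∃ C : ℝ, ∀ a b : ℤ, IsCoprime a b → a * b * (a + b) ≠ 0 →
      ∀ (N : ℕ) [NeZero N], (freyCurve a b).conductorNorm ℤ = N → ∀ q : ℕ, q.Prime → q ≠ 2 → q ∣ N →
        (brandtXi (N / q) q (fun n => (freyCurve a b).LFunction n) : ℝ) *
          ((((freyCurve a b).minimalDiscriminantNorm ℤ).factorization q : ℕ) : ℝ) ≤
            C * (N : ℝ) ^ (2 + ε)) ↔ FreyDegreeBound :=
  primeXiStrongBound_iff_freyDegreeBound hT hIVT (definiteRTControlPrime_of_items hT hMK hIVT) hMod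

/-! ## (2) Every admissible `N⁻`: section hypotheses `hTlev`, `hT2` (Takahashi 2001 Thm. 2.3 for `X₀^D(M)` at
`p ∥ M` and at `p ∣ D` with Thm. 3.2 (a) — verbatim those of `DefiniteXiXiStrongBoundDegreeCalibration.lean`), the
r9 item `IsogenyValuationTransport` and Jacquet–Langlands data -/

section Takahashi

variable
  (hTlev : ∀ {N D M p m : ℕ}, p.Prime → M = p * m → ¬ p ∣ m → IsAdmissibleFactorization N D M →
    ∀ (X : ShimuraCurveData D M) (W : WeierstrassCurve ℚ) [W.IsElliptic], W.conductorNorm ℤ = N →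
    ∀ (W' : WeierstrassCurve ℚ) [W'.IsElliptic] (P : ShimuraParametrizationData X W'),
      P.IsMinimalFor W →
    ∀ S : Brandt.XiSetup m (D * p),
      ∃ i j : ℕ, 0 < i ∧ i * j = (W'.minimalDiscriminantNorm ℤ).factorization p ∧
        i ∣ S.xi (fun n => W'.LFunction n) ∧ P.deg * i = S.xi (fun n => W'.LFunction n) * j)
  (hT2 : ∀ {N D M p d : ℕ}, p.Prime → D = p * d → IsAdmissibleFactorization N D M →
    ∀ (X : ShimuraCurveData D M) (W : WeierstrassCurve ℚ) [W.IsElliptic], W.conductorNorm ℤ = N →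
    ∀ (W' : WeierstrassCurve ℚ) [W'.IsElliptic] (P : ShimuraParametrizationData X W'),
      P.IsMinimalFor W →
    ∀ S : Brandt.XiSetup (p * M) d,
      ∃ i j : ℕ, 0 < i ∧ i * j = (W'.minimalDiscriminantNorm ℤ).factorization p ∧
        i ∣ S.xi (fun n => W'.LFunction n) ∧ P.deg * i = S.xi (fun n => W'.LFunction n) * j)
  (hIVT : IsogenyValuationTransport) (hJL : nonempty_shimuraParametrizationData)

include hTlev hT2 hIVT hJL

/-- **`XiStrongBound ⟺ FreyDegreeBound` over items** (section form): modulo `hTlev`, `hT2`,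
Jacquet–Langlands data, Takahashi 2001 Thm. 2.3 at `q ∥ N` and the route items
`IsogenyValuationTransport`, `MazurKenkuBound`, `FreyModularity` (r3 discharged by
`definiteRTControlPrime_of_items`). [cite: Takahashi2001, Thm. 2.3 (p. 79), Thm. 3.2 (a) (p. 82)] [cite: PastenShimura2024, §3 p. 13, Lemma 6.8 p. 22, §6.9 p. 25] -/
theorem xiStrongBound_iff_freyDegreeBound_of_items' (hT : takahashi2001_thm_2_3_of_coprime)
    (hMK : MazurKenkuBound) (hMod : FreyModularity) : XiStrongBound ↔ FreyDegreeBound :=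
  xiStrongBound_iff_freyDegreeBound_of_facts hTlev hT2 hIVT hJL
    (definiteRTControlPrime_of_items hT hMK hIVT) hMod

/-- **The full crux ⟺ its prime rung over items** (same hypotheses): the composite-`N⁻` instances of the
crux, never consumed by `closes`, follow from the prime rung through `X`.
[cite: Takahashi2001, Thm. 2.3 (p. 79), Thm. 3.2 (a) (p. 82)] [cite: PastenShimura2024, §3 p. 13, Lemma 6.8 p. 22] -/
theorem xiStrongBound_iff_primeXiStrongBound_of_items (hT : takahashi2001_thm_2_3_of_coprime)
    (hMK : MazurKenkuBound) (hMod : FreyModularity) :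
    XiStrongBound ↔
      (∀ ε : ℝ, 0 < ε → ∃ C : ℝ, ∀ a b : ℤ, IsCoprime a b → a * b * (a + b) ≠ 0 →
        ∀ (N : ℕ) [NeZero N], (freyCurve a b).conductorNorm ℤ = N → ∀ q : ℕ, q.Prime → q ≠ 2 → q ∣ N →
          (brandtXi (N / q) q (fun n => (freyCurve a b).LFunction n) : ℝ) *
            ((((freyCurve a b).minimalDiscriminantNorm ℤ).factorization q : ℕ) : ℝ) ≤
              C * (N : ℝ) ^ (2 + ε)) :=
  xiStrongBound_iff_primeXiStrongBound_of_facts hTlev hT2 hIVT hJL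
    (definiteRTControlPrime_of_items hT hMK hIVT) hMod

end Takahashi

/-- **Registered calibration sub-goal of stmt-ABC-11337 (line `SplitProof`, lead c21): `XiStrongBound ⟺ FreyDegreeBound`
over ROUTE ITEMS** — hypotheses, in order: Takahashi 2001 Thm. 2.3 for `X₀^D(M)` at `p ∥ M` (`hTlev`) and at `p ∣ D` with
Thm. 3.2 (a) (`hT2`), the r9 item `IsogenyValuationTransport`, Jacquet–Langlands data, Takahashi 2001 Thm. 2.3 at `q ∥ N`
(`takahashi2001_thm_2_3_of_coprime`), the r9 items `MazurKenkuBound` and `FreyModularity`; header fully qualified, verbatim the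
registered signature. [cite: Takahashi2001, Thm. 2.3 (p. 79), Thm. 3.2 (a) (p. 82)] [cite: PastenShimura2024, §3 p. 13, Lemma 6.8 p. 22, §6.9 p. 25] -/
theorem xiStrongBound_iff_freyDegreeBound_of_items : (∀ {N D M p m : ℕ}, p.Prime → M = p * m → ¬ p ∣ m → Literature.NumberTheory.Automorphic.IsAdmissibleFactorization N D M → ∀ (X : Literature.NumberTheory.Automorphic.ShimuraCurveData D M) (W : WeierstrassCurve ℚ) [W.IsElliptic], W.conductorNorm ℤ = N → ∀ (W' : WeierstrassCurve ℚ) [W'.IsElliptic] (P : Literature.NumberTheory.Automorphic.ShimuraParametrizationData X W'), P.IsMinimalFor W → ∀ S : Literature.NumberTheory.Automorphic.Brandt.XiSetup m (D * p), ∃ i j : ℕ, 0 < i ∧ i * j = (W'.minimalDiscriminantNorm ℤ).factorization p ∧ i ∣ S.xi (fun n => W'.LFunction n) ∧ P.deg * i = S.xi (fun n => W'.LFunction n) * j) → (∀ {N D M p d : ℕ}, p.Prime → D = p * d → Literature.NumberTheory.Automorphic.IsAdmissibleFactorization N D M → ∀ (X : Literature.NumberTheory.Automorphic.ShimuraCurveData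 D M) (W : WeierstrassCurve ℚ) [W.IsElliptic], W.conductorNorm ℤ = N → ∀ (W' : WeierstrassCurve ℚ) [W'.IsElliptic] (P : Literature.NumberTheory.Automorphic.ShimuraParametrizationData X W'), P.IsMinimalFor W → ∀ S : Literature.NumberTheory.Automorphic.Brandt.XiSetup (p * M) d, ∃ i j : ℕ, 0 < i ∧ i * j = (W'.minimalDiscriminantNorm ℤ).factorization p ∧ i ∣ S.xi (fun n => W'.LFunction n) ∧ P.deg * i = S.xi (fun n => W'.LFunction n) * j) → Summit.ABC.ABC.Theses.DefiniteXi.IsogenyValuationTransport → Literature.NumberTheory.Automorphic.nonempty_shimuraParametrizationData → Literature.NumberTheory.EllipticCurves.takahashi2001_thm_2_3_of_coprime → Summit.ABC.ABC.Theses.DefiniteXi.MazurKenkuBound → Summit.ABC.ABC.Theses.DefiniteXi.FreyModularity → (Summit.ABC.ABC.Theses.DefiniteXi.XiStrongBound ↔ Summit.ABC.ABC.Theses.DefiniteXi.FreyDegreeBound) :=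
  fun hTlev hT2 hIVT hJL hT hMK hMod => xiStrongBound_iff_freyDegreeBound_of_items' hTlev hT2 hIVT hJL hT hMK hMod

end Summit.ABC.ABC.Theorems.DefiniteXiXiStrongBoundItemsCalibration

end
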